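import Summits.Parity.GeneralizedHardyLittlewood.Theorems.PrimeLevelFamEdgeIdeaDeltasWucSigmaDefs
import HarnessLib

/-!
# Route `PrimeLevelFamEdge` — TYPED IDEA DELTAS, deck 19b: the (κ,σ)-edge OPENS THE DOOR — `ZetaPairsTransfer` (proved
# for quadratic fields), `H_Σ(κ,σ) ∧ κ+σ < A/(A+6) ∧ Thm 1.1 ⇒ LOneLowerBoundOdd N` (`N ≥ 4A+18`), and CI's interior
# point upgraded: `X ∧ conreyIwaniec2002_theorem11 ⇒ LOneLowerBoundOdd 75` (§3–§5)

LANDING NOTE (typer ls-idea-typ-1 gen 2, cell ls-idea): the seat's `Sketch_Wuc24.lean` v1.1 sha16 195cf539609374a8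
(seat ls-idea-lens-24, `wuc` × CI-GAPS; cards K-L24-1 «THE DOOR HAS AN EDGE» / K-L24-2; critic F b5/b8 PASS as PROVED
COMPOSITIONS modulo the NAMED FACT `conreyIwaniec2002_theorem11`; T-L24-1 discharged in sketch form) VERBATIM up to the
namespace (`Literature.NumberTheory.LFunctions.Wuc24` → the deck namespace `.WucSigma`), the split 19a (§0–§2) / 19b
(§3–§5) for the 400-line rule, four added docstrings, the seat's `closeCriticalZeros_finite'` dropped (tree
`BGMM2023.closeCriticalZeros_finite`) and `one_le_log_of_exp_one_le` private (tree duplicate).  Landed Summits-side (uncited compositions over tree objects;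
the q-odd fidelity of the FACT is kept in the docstrings, F P-F6-1); the CI-GAPS door of record reads «X ⇒ odd 75 via
Thm 1.1 (ψ = 1, A = 57/4) mod FACT `conreyIwaniec2002_theorem11` │ odd 90 via Thm 1.2 mod FACT `…theorem12`» — never
«75 proved» (F P-F6-2).

Typed ≠ proved: the NAMED FACT `conreyIwaniec2002_theorem11` (Acta Arith. 103 (2002) Thm 1.1, ψ = 1) is a HYPOTHESIS
everywhere below; nothing here proves `X`, any rung, the odd leaf unconditionally, or any exceptional-zero statement.
-/

noncomputable section

namespace Summit.Parity.GeneralizedHardyLittlewood.Theorems.PrimeLevelFamEdgeIdeaDeltas.WucSigma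

open _root_.Complex NumberField Literature.NumberTheory.LFunctions.NumberField
open Literature.NumberTheory.LFunctions Literature.NumberTheory.LFunctions.ConreyIwaniec2002

/-! ### §3 The edge opens the door (modulo the NAMED FACT Theorem 1.1 and the ζ ⊂ ζ_K pair transfer) -/

/-- **Pair transfer at `ψ = 1`** (hypothesis, abbreviating the factorisation `ζ_K = ζ · L(·,χ_K)` on the
critical line, CI §1 / Iwaniec CIME (6.5), which is not yet a tree lemma): every close critical pair of
`ζ` at radius parameter `α` below height `T` is a close critical pair of the class-group `L`-function
of `K` at the trivial character, as a COUNT inequality. -/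
def ZetaPairsTransfer (K : Type) [Field K] [NumberField K] : Prop :=
  ∀ α T : ℝ, ((closeZeroOrdinates riemannZeta α T).ncard : ℝ) ≤
    (closeZeroCount (classGroupLFunction K 1) α T : ℝ)

/-- **K-L24-1, the door on the edge.** `H_Σ(κ,σ)` with `σ > 0` and `κ + σ < A/(A+6)` gives, through
Conrey–Iwaniec's Theorem 1.1 at `ψ = 1` (NAMED FACT `conreyIwaniec2002_theorem11`, hypothesis) and
the pair transfer, `L(1,χ) ≥ (log q)^{−(4A+18)}` for every large odd primitive quadratic `χ`.
Choice of parameters: `log T = (log q)^{A+6}` exactly, `α = (log T)^{−σ}`. Typed ≠ proved for the two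
hypotheses; the composition itself is proved. -/
theorem lOne_lowerBound_of_sigma {κ σ A : ℝ} (hA : 0 ≤ A) (hσ : 0 < σ)
    (hsum : κ + σ < A / (A + 6)) (hCI : conreyIwaniec2002_theorem11)
    (h : SubnormalGapsHypothesisSigma κ σ) :
    ∃ q₀ : ℕ, ∀ (q : ℕ) [NeZero q], q₀ ≤ q → 4 < q →
      ∀ χ : DirichletCharacter ℂ q, χ.IsPrimitive → χ.IsQuadratic → χ.Odd →
        ∀ (K : Type) [Field K] [NumberField K],
          Module.finrank ℚ K = 2 → NumberField.discr K = -(q : ℤ) → ZetaPairsTransfer K →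
            Real.log q ^ (-(4 * A + 18)) ≤ ‖χ.LFunction 1‖ := by
  obtain ⟨c, hc, hci⟩ := hCI
  obtain ⟨c₀, hc₀, T₀, hT₀⟩ := h
  obtain ⟨δ, hδ⟩ : ∃ δ : ℝ, A / (A + 6) - (κ + σ) = δ := ⟨_, rfl⟩
  have hδpos : 0 < δ := by rw [← hδ]; linarith
  obtain ⟨R₁, hR₁⟩ : ∃ R₁ : ℝ, (c / c₀) ^ δ⁻¹ = R₁ := ⟨_, rfl⟩
  obtain ⟨q₀, hq₀⟩ : ∃ q₀ : ℕ, max T₀ (Real.exp R₁) ≤ q₀ := exists_nat_ge _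
  refine ⟨q₀, fun q _ hq hq4 χ hprim hquad hodd K _ _ h2 hdisc htrans => ?_⟩
  have hqreal : (q₀ : ℝ) ≤ q := by exact_mod_cast hq
  have hq5 : (5 : ℝ) ≤ q := by exact_mod_cast (show 5 ≤ q by omega)
  have hqpos : (0 : ℝ) < q := by linarith
  obtain ⟨L, hL⟩ : ∃ L : ℝ, Real.log (q : ℝ) = L := ⟨_, rfl⟩
  have hL1 : 1 ≤ L := by
    rw [← hL, ← Real.log_exp 1]
    exact Real.log_le_log (Real.exp_pos 1) (by linarith [Real.exp_one_lt_d9])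
  have hLpos : 0 < L := by linarith
  obtain ⟨M, hM⟩ : ∃ M : ℝ, L ^ (A + 6) = M := ⟨_, rfl⟩
  have hM_ge_L : L ≤ M := by
    have := Real.rpow_le_rpow_of_exponent_le hL1 (show (1 : ℝ) ≤ A + 6 by linarith)
    rwa [Real.rpow_one, hM] at this
  have hM1 : 1 ≤ M := hL1.trans hM_ge_L
  have hMpos : 0 < M := by linarith
  obtain ⟨T, hT⟩ : ∃ T : ℝ, Real.exp M = T := ⟨_, rfl⟩
  have hTpos : 0 < T := by rw [← hT]; exact Real.exp_pos M
  have hlogT : Real.log T = M := by rw [← hT, Real.log_exp]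
  have hT2 : 2 ≤ T := by
    have h1 : Real.exp 1 ≤ T := by rw [← hT]; exact Real.exp_le_exp.2 hM1
    linarith [Real.add_one_le_exp (1 : ℝ)]
  have hTq : (q : ℝ) ≤ T := by
    have e : Real.exp L = q := by rw [← hL, Real.exp_log hqpos]
    rw [← e, ← hT]; exact Real.exp_le_exp.2 hM_ge_L
  have hTT₀ : T₀ ≤ T := le_trans (le_trans (le_max_left _ _) hq₀) (hqreal.trans hTq)
  obtain ⟨α, hα⟩ : ∃ α : ℝ, M ^ (-σ) = α := ⟨_, rfl⟩
  have hαpos : 0 < α := by rw [← hα]; exact Real.rpow_pos_of_pos hMpos _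
  have hα1 : α ≤ 1 := by
    rw [← hα]; exact Real.rpow_le_one_of_one_le_of_nonpos hM1 (by linarith)
  -- `H_Σ` at height `T`
  have hcount₀ := hT₀ T hTT₀
  rw [hlogT, hα] at hcount₀
  -- `c / c₀ ≤ M ^ δ` (this is where `q₀` is large)
  have hcc : c / c₀ ≤ M ^ δ := by
    have h1 : Real.exp R₁ ≤ q := le_trans (le_trans (le_max_right _ _) hq₀) hqreal
    have h2' : R₁ ≤ L := by
      rw [← hL, ← Real.log_exp R₁]; exact Real.log_le_log (Real.exp_pos _) h1
    have hR₁M : R₁ ≤ M := h2'.trans hM_ge_L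
    have hR₁nn : 0 ≤ R₁ := by rw [← hR₁]; exact Real.rpow_nonneg (div_pos hc hc₀).le _
    have h3 := Real.rpow_le_rpow hR₁nn hR₁M hδpos.le
    rwa [← hR₁, Real.rpow_inv_rpow (div_pos hc hc₀).le hδpos.ne'] at h3
  have hA6 : 0 < A + 6 := by linarith
  have hLA : L ^ A = M ^ (A / (A + 6)) := by
    rw [← hM, ← Real.rpow_mul hLpos.le]; congr 1; field_simp
  -- the Theorem-1.1 count hypothesis at `ψ = 1`
  have hcount : c * T * Real.log T / (α * Real.log q ^ A) ≤
      (closeZeroCount (classGroupLFunction K 1) α T : ℝ) := by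
    rw [hlogT, hL]
    have e1 : α * L ^ A = M ^ (A / (A + 6) - σ) := by
      rw [← hα, hLA, ← Real.rpow_add hMpos]; congr 1; ring
    have e2 : c * T * M / (α * L ^ A) = c * T * M ^ (1 - (A / (A + 6) - σ)) := by
      rw [e1, Real.rpow_sub hMpos 1 (A / (A + 6) - σ), Real.rpow_one]; ring
    have step : c * T * M ^ (1 - (A / (A + 6) - σ)) ≤ c₀ * T * M ^ (1 - κ) := by
      have e3 : M ^ (1 - κ) = M ^ δ * M ^ (1 - (A / (A + 6) - σ)) := by
        rw [← Real.rpow_add hMpos]; congr 1; rw [← hδ]; ring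
      rw [e3]
      have hc' : c ≤ c₀ * M ^ δ := by
        have h1 := mul_le_mul_of_nonneg_left hcc hc₀.le
        have e : c₀ * (c / c₀) = c := by field_simp
        linarith
      calc c * T * M ^ (1 - (A / (A + 6) - σ))
            = c * (T * M ^ (1 - (A / (A + 6) - σ))) := by ring
        _ ≤ (c₀ * M ^ δ) * (T * M ^ (1 - (A / (A + 6) - σ))) :=
            mul_le_mul_of_nonneg_right hc' (by positivity)
        _ = c₀ * T * (M ^ δ * M ^ (1 - (A / (A + 6) - σ))) := by ring
    rw [e2]
    exact step.trans (hcount₀.trans (htrans α T))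
  have key := hci A hA q hq4 χ hprim hquad hodd K h2 hdisc 1 T α hT2 hαpos hα1
    (le_of_eq (by rw [hlogT, hL, hM])) hcount
  have e4 : Real.log T ^ (-(2 : ℝ)) * Real.log (q : ℝ) ^ (-(2 * A + 6)) =
      Real.log (q : ℝ) ^ (-(4 * A + 18)) := by
    rw [hlogT, hL, ← hM, ← Real.rpow_mul hLpos.le, ← Real.rpow_add hLpos]; congr 1; ring
  rw [← e4]; exact key

/-! ### §4 Discharging the pair transfer for quadratic fields: `ζ_K = ζ · L(·,κ_K)` -/

/-- Transport of `HasCloseZero` to a function agreeing with `L₁` on the critical line and near the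
centre point `½ + iγ`. -/
theorem hasCloseZero_congr {L₁ L₂ : ℂ → ℂ} {r γ : ℝ}
    (hline : ∀ t : ℝ, L₂ (1 / 2 + t * I) = L₁ (1 / 2 + t * I))
    (hnhds : L₂ =ᶠ[nhds (1 / 2 + γ * I)] L₁) (h : HasCloseZero L₁ r γ) : HasCloseZero L₂ r γ := by
  obtain ⟨hz, hrest⟩ := h
  refine ⟨by rw [hline]; exact hz, ?_⟩
  rcases hrest with hder | ⟨γ', hne, hz', hdist⟩
  · left; rw [hnhds.deriv_eq]; exact hder
  · right; exact ⟨γ', hne, by rw [hline]; exact hz', hdist⟩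

/-- Ordinates `2 ≤ γ ≤ T` of critical zeros of `L(·,κ)`, `κ ≠ 1`, form a finite set
(from `DirichletDetector.finite_zeros_closedBall`). -/
theorem critOrdinates_LFunction_finite {M : ℕ} [NeZero M] {κ : DirichletCharacter ℂ M} (hκ : κ ≠ 1)
    (T : ℝ) : {γ : ℝ | 2 ≤ γ ∧ γ ≤ T ∧ κ.LFunction (1 / 2 + γ * I) = 0}.Finite := by
  refine ((DirichletDetector.finite_zeros_closedBall hκ 0 (|T| + 1)).image Complex.im).subset ?_
  rintro γ ⟨h2, hT, hz⟩
  have hre : ((1 / 2 : ℂ) + γ * I).re = 1 / 2 := by simp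
  have him : ((1 / 2 : ℂ) + γ * I).im = γ := by simp
  refine ⟨1 / 2 + γ * I, ⟨?_, hz⟩, him⟩
  rw [Metric.mem_closedBall, dist_zero_right]
  calc ‖(1 / 2 : ℂ) + γ * I‖ ≤ |((1 / 2 : ℂ) + γ * I).re| + |((1 / 2 : ℂ) + γ * I).im| :=
        Complex.norm_le_abs_re_add_abs_im _
    _ = 1 / 2 + γ := by rw [hre, him, abs_of_nonneg (by norm_num), abs_of_nonneg (by linarith)]
    _ ≤ |T| + 1 := by linarith [le_abs_self T]

/-- The points `½ + it` are not the pole `s = 1`. (private copy; the tree has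
`one_half_add_ne_one` in `NymanBeurlingDirichlet`). -/
private theorem half_add_mul_I_ne_one (t : ℝ) : (1 / 2 : ℂ) + t * I ≠ 1 := by
  intro h
  have := congrArg Complex.re h
  norm_num at this

/-- **Pair transfer holds for every quadratic field** (`[K:ℚ] = 2`): `ζ_K(s) = ζ(s)L(s,κ_K)` off
`s = 1` (`exists_kroneckerChar`, `dedekindZetaCont_eq_riemannZeta_mul_LFunction`,
`classGroupLFunction_one`), so every close critical pair of `ζ` is one of `L(s, ψ = 1) = ζ_K`
(`hasCloseZero_mul`), and the `ζ_K`-side ordinate set is finite (zeros of `ζ` and of `L(·,κ_K)`). -/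
theorem zetaPairsTransfer_of_quadratic (K : Type) [Field K] [NumberField K]
    (h2 : Module.finrank ℚ K = 2) : ZetaPairsTransfer K := by
  intro α T
  obtain ⟨M, hM, κ, -, hκ, -, hfac⟩ :=
    Literature.NumberTheory.QuadraticFields.Quadratic.exists_kroneckerChar (K := K) h2
  -- the factorisation off `s = 1`
  have hprod : ∀ s : ℂ, s ≠ 1 → classGroupLFunction K 1 s = riemannZeta s * κ.LFunction s := by
    intro s hs
    rw [classGroupLFunction_one K hs]
    exact Literature.NumberTheory.QuadraticFields.Quadratic.dedekindZetaCont_eq_riemannZeta_mul_LFunction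
      hκ hfac hs
  have hline : ∀ t : ℝ, classGroupLFunction K 1 (1 / 2 + t * I) =
      (fun s => riemannZeta s * κ.LFunction s) (1 / 2 + t * I) :=
    fun t => hprod _ (half_add_mul_I_ne_one t)
  have hnhds : ∀ t : ℝ, classGroupLFunction K 1 =ᶠ[nhds (1 / 2 + t * I)]
      (fun s => riemannZeta s * κ.LFunction s) := by
    intro t
    have hopen : IsOpen ({1}ᶜ : Set ℂ) := isOpen_compl_singleton
    filter_upwards [hopen.mem_nhds (half_add_mul_I_ne_one t)] with s hs
    exact hprod s hs
  -- inclusion of the ordinate sets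
  have hsub : closeZeroOrdinates riemannZeta α T ⊆ closeZeroOrdinates (classGroupLFunction K 1) α T := by
    rintro γ ⟨hγ2, hγT, hclose⟩
    refine ⟨hγ2, hγT, hasCloseZero_congr hline (hnhds γ) ?_⟩
    exact hasCloseZero_mul (differentiableAt_riemannZeta (half_add_mul_I_ne_one γ))
      (DirichletCharacter.differentiable_LFunction hκ _) hclose
  -- finiteness of the larger set
  have hfin : (closeZeroOrdinates (classGroupLFunction K 1) α T).Finite := by
    refine (((critOrdinates_finite T).union (critOrdinates_LFunction_finite hκ T))).subset ?_
    rintro γ ⟨hγ2, hγT, hz, -⟩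
    rw [hline γ] at hz
    rcases mul_eq_zero.1 hz with h | h
    · exact Or.inl ⟨by linarith, hγT, h⟩
    · exact Or.inr ⟨hγ2, hγT, h⟩
  exact_mod_cast Set.ncard_le_ncard hsub hfin

/-- **The door on the edge, hypothesis-minimal form**: as `lOne_lowerBound_of_sigma`, with the pair
transfer discharged (`zetaPairsTransfer_of_quadratic`); only the NAMED FACT Theorem 1.1 remains. -/
theorem lOne_lowerBound_of_sigma' {κ σ A : ℝ} (hA : 0 ≤ A) (hσ : 0 < σ)
    (hsum : κ + σ < A / (A + 6)) (hCI : conreyIwaniec2002_theorem11)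
    (h : SubnormalGapsHypothesisSigma κ σ) :
    ∃ q₀ : ℕ, ∀ (q : ℕ) [NeZero q], q₀ ≤ q → 4 < q →
      ∀ χ : DirichletCharacter ℂ q, χ.IsPrimitive → χ.IsQuadratic → χ.Odd →
        ∀ (K : Type) [Field K] [NumberField K],
          Module.finrank ℚ K = 2 → NumberField.discr K = -(q : ℤ) →
            Real.log q ^ (-(4 * A + 18)) ≤ ‖χ.LFunction 1‖ := by
  obtain ⟨q₀, hq₀⟩ := lOne_lowerBound_of_sigma hA hσ hsum hCI h
  exact ⟨q₀, fun q _ hq hq4 χ hprim hquad hodd K _ _ h2 hdisc =>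
    hq₀ q hq hq4 χ hprim hquad hodd K h2 hdisc (zetaPairsTransfer_of_quadratic K h2)⟩

/-! ### §5 All the way to the leaf's odd half: `H_Σ(κ,σ) ∧ κ+σ < A/(A+6) ∧ Thm 1.1 ⇒ LOneLowerBoundOdd N`, `N ≥ 4A+18` -/

/-- A positive function on a finite type has a positive lower bound. -/
theorem exists_pos_le_of_finite {ι : Type*} [Finite ι] (f : ι → ℝ) (hf : ∀ i, 0 < f i) :
    ∃ m : ℝ, 0 < m ∧ ∀ i, m ≤ f i := by
  rcases isEmpty_or_nonempty ι with hι | hι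
  · exact ⟨1, one_pos, fun i => (IsEmpty.false i).elim⟩
  · haveI := Fintype.ofFinite ι
    obtain ⟨i₀, -, hi₀⟩ := Finset.exists_min_image Finset.univ f Finset.univ_nonempty
    exact ⟨f i₀, hf i₀, fun i => hi₀ i (Finset.mem_univ i)⟩

/-- Uniform positive lower bound for `‖L(1,χ)‖` over the finitely many non-trivial characters of
modulus `< q₁` (`L(1,χ) ≠ 0`, Mathlib). -/
theorem exists_lOne_lower_lt (q₁ : ℕ) : ∃ m : ℝ, 0 < m ∧
    ∀ (D : ℕ) [NeZero D] (χ : DirichletCharacter ℂ D), D < q₁ → χ ≠ 1 → m ≤ ‖χ.LFunction 1‖ := by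
  induction q₁ with
  | zero => exact ⟨1, one_pos, fun D _ χ hD _ => absurd hD (Nat.not_lt_zero _)⟩
  | succ n ih =>
    obtain ⟨m, hm, h⟩ := ih
    rcases Nat.eq_zero_or_pos n with hn | hn
    · refine ⟨m, hm, fun D _ χ hD _ => ?_⟩
      exact absurd (show D = 0 by omega) (NeZero.ne D)
    · haveI : NeZero n := ⟨by omega⟩
      obtain ⟨m', hm', h'⟩ := exists_pos_le_of_finite
        (fun χ : DirichletCharacter ℂ n => if χ = 1 then (1 : ℝ) else ‖χ.LFunction 1‖)
        (fun χ => by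
          by_cases hχ : χ = 1
          · simp [hχ]
          · simp only [hχ, if_false]
            exact norm_pos_iff.2 (DirichletCharacter.LFunction_apply_one_ne_zero hχ))
      refine ⟨min m m', lt_min hm hm', fun D _ χ hD hχ => ?_⟩
      rcases (Nat.lt_succ_iff.1 hD).lt_or_eq with hlt | heq
      · exact (min_le_left _ _).trans (h D χ hlt hχ)
      · subst heq
        have := h' χ
        simp only [hχ, if_false] at this
        exact (min_le_right _ _).trans this

/-- **K-L24-1 reaches the leaf's odd half**: `H_Σ(κ,σ)` (`σ > 0`), the budget `κ + σ < A/(A+6)`,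
an exponent `N ≥ 4A + 18` and the NAMED FACT Theorem 1.1 give `LOneLowerBoundOdd N`. The field
`K = ℚ(√−D)` comes from `exists_quadraticField_of_odd_primitive`; small conductors are absorbed by
`L(1,χ) ≠ 0`. At `A = 501`: `N = 2022` needs `κ + σ < 501/507`. Typed ≠ proved for Theorem 1.1. -/
theorem lOneLowerBoundOdd_of_sigma {κ σ A : ℝ} {N : ℕ} (hA : 0 ≤ A) (hσ : 0 < σ)
    (hsum : κ + σ < A / (A + 6)) (hN : 4 * A + 18 ≤ N) (hCI : conreyIwaniec2002_theorem11)
    (h : SubnormalGapsHypothesisSigma κ σ) : LOneLowerBoundOdd N := by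
  obtain ⟨q₀, hq₀⟩ := lOne_lowerBound_of_sigma' hA hσ hsum hCI h
  obtain ⟨m, hm, hsmall⟩ := exists_lOne_lower_lt (max q₀ 5)
  refine ⟨min (1 / 2) (m / 2), by positivity, fun D _ χ hD hq hp ho => ?_⟩
  have h3 : (3 : ℝ) ≤ D := by exact_mod_cast hD
  have hlog1 : 1 ≤ Real.log (D : ℝ) := by
    rw [← Real.log_exp 1]
    exact Real.log_le_log (Real.exp_pos 1) (by linarith [Real.exp_one_lt_d9])
  have hlogpos : 0 < Real.log (D : ℝ) := by linarith
  have hpow1 : 1 ≤ Real.log (D : ℝ) ^ N := one_le_pow₀ hlog1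
  have hpow : 0 < Real.log (D : ℝ) ^ N := by positivity
  by_cases hbig : max q₀ 5 ≤ D
  · have hq₀D : q₀ ≤ D := le_trans (le_max_left _ _) hbig
    have h4 : 4 < D := by have := le_trans (le_max_right _ _) hbig; omega
    obtain ⟨K, hF, hNF, h2, hdisc⟩ :=
      Literature.NumberTheory.QuadraticFields.Quadratic.exists_quadraticField_of_odd_primitive hp hq ho
    have key := hq₀ D hq₀D h4 χ hp hq ho K h2 hdisc
    have hle : (Real.log (D : ℝ) ^ N)⁻¹ ≤ Real.log (D : ℝ) ^ (-(4 * A + 18)) := by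
      rw [← Real.rpow_natCast, ← Real.rpow_neg hlogpos.le]
      exact Real.rpow_le_rpow_of_exponent_le hlog1 (by linarith)
    calc min (1 / 2) (m / 2) / Real.log D ^ N ≤ (1 / 2) / Real.log D ^ N :=
          div_le_div_of_nonneg_right (min_le_left _ _) hpow.le
      _ < 1 / Real.log D ^ N := by
          apply div_lt_div_of_pos_right _ hpow; norm_num
      _ = (Real.log (D : ℝ) ^ N)⁻¹ := one_div _
      _ ≤ Real.log (D : ℝ) ^ (-(4 * A + 18)) := hle
      _ ≤ ‖χ.LFunction 1‖ := key
  · push Not at hbig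
    have hχ1 : χ ≠ 1 := by
      rintro rfl
      have hc : DirichletCharacter.conductor (1 : DirichletCharacter ℂ D) = D := hp
      rw [DirichletCharacter.conductor_one] at hc
      omega
    have hmle := hsmall D χ hbig hχ1
    calc min (1 / 2) (m / 2) / Real.log D ^ N ≤ min (1 / 2) (m / 2) :=
          div_le_self (by positivity) hpow1
      _ ≤ m / 2 := min_le_right _ _
      _ < m := by linarith
      _ ≤ ‖χ.LFunction 1‖ := hmle

/-- **The leaf's full exponent**: on the leaf-compatible edge `κ + σ < 501/507` (`σ > 0`),
`H_Σ(κ,σ)` and Theorem 1.1 give `LOneLowerBoundOdd 2022` (`A = 501`). -/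
theorem lOneLowerBoundOdd_2022_of_sigma {κ σ : ℝ} (hσ : 0 < σ) (hsum : κ + σ < 501 / 507)
    (hCI : conreyIwaniec2002_theorem11) (h : SubnormalGapsHypothesisSigma κ σ) :
    LOneLowerBoundOdd 2022 :=
  lOneLowerBoundOdd_of_sigma (A := 501) (by norm_num) hσ (by norm_num; linarith) (by norm_num) hCI h

/-- **CI's interior point, upgraded**: `X` (any `c > 0`) and Theorem 1.1 give `LOneLowerBoundOdd 75`
(`κ = 1/5`, `σ = 1/2`, any `A > 14`; here `A = 57/4`, `4A + 18 = 75`), against the printed `90` of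
Theorem 1.2. Typed ≠ proved for Theorem 1.1; this is NOT a proof of (1.22). -/
theorem lOneLowerBoundOdd_75_of_subnormalGaps {c : ℝ} (hc : 0 < c) (hX : SubnormalGapsHypothesis c)
    (hCI : conreyIwaniec2002_theorem11) : LOneLowerBoundOdd 75 :=
  lOneLowerBoundOdd_of_sigma (A := 57 / 4) (by norm_num) (by norm_num : (0:ℝ) < 1 / 2)
    (by norm_num) (by norm_num) hCI (sigma_half_of_subnormalGaps hc hX)

/-- The leaf-compatible reading: exponent `4A + 18 ≤ 2022 ⇔ A ≤ 501`, and then `A/(A+6) ≤ 501/507`: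
the edge of K-L24-1 is the segment `κ + σ < 501/507` (cf. `ciGaps_budget_iff`, `dedekind_budget_iff`). -/
theorem sigma_leaf_budget {A : ℝ} (hA : 0 ≤ A) (hE : 4 * A + 18 ≤ 2022) : A / (A + 6) ≤ 501 / 507 := by
  have h1 : A ≤ 501 := by linarith
  have h2 : 0 < A + 6 := by linarith
  rw [div_le_div_iff₀ h2 (by norm_num)]
  nlinarith

end Summit.Parity.GeneralizedHardyLittlewood.Theorems.PrimeLevelFamEdgeIdeaDeltas.WucSigma

end
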